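import Literature.NumberTheory.Transcendental.CalegariDimitrovTangHARadius
import Mathlib.Tactic
import HarnessLib

/-!
# The radius of convergence of `H_B` and `H_C` is `1/9` (CDT Lemma 121, third bullet)

Calegari–Dimitrov–Tang, arXiv:2408.15403, §11.1 Lemma 121 (p. 101): "The radius of convergence of
`H_A(x)`, `H_B(x)`, and `H_C(x)` is `R = 1/9`." In the tree `b_n`, `c_n` are defined through
Zagier's recurrence `(n+1)² u_{n+1} − (10n² + 10n + 3) u_n + 9n² u_{n−1} = 0` resp. `= 1`
(`CalegariDimitrovTang.hB`, `hC`, rows `hB_rec`, `hC_rec`), from `b₀ = c₀ = 0`, `b₁ = c₁ = 1`.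
The recurrence is monotonicity-preserving: if `0 ≤ u_n ≤ u_{n+1}` then
`(n+2)² u_{n+2} ≥ ((n+1)² + 10(n+1) + 3) u_{n+1} − δ ≥ (n+2)² u_{n+1}` as soon as
`(8n+10) u_{n+1} ≥ δ` (`δ` the defect of the row). Applied to `b`, `a − b`, `b − a/6`, `c − b`,
`a − c` this sandwiches `a_n/6 ≤ b_n ≤ c_n ≤ a_n` (`n ≥ 1`), whence, by the bounds
`9ⁿ/((n+1)²(2n+1)) ≤ a_n ≤ 9ⁿ` of `CalegariDimitrovTangHARadius`, radius `1/9` for both.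

* `CalegariDimitrovTang.zagierRec_mono` — the monotonicity principle for the recurrence.
* `CalegariDimitrovTang.hB_le_zagierC`, `zagierC_le_six_mul_hB`, `hB_le_hC`, `hC_le_zagierC`.
* `CalegariDimitrovTang.radius_ofScalars_eq_of_sandwich` — radius `1/9` from a two-sided
  comparison with `a_n`.
* `CalegariDimitrovTang.radius_ofScalars_hB`, `radius_ofScalars_hC` — **radius `1/9`**.

No named facts.

## References

* [CalegariDimitrovTang2024] arXiv:2408.15403, §11.1 Lemma 121 (p. 101).
-/

noncomputable section

open Filter Topology NNReal ENNReal

namespace Literature.NumberTheory.Transcendental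

namespace CalegariDimitrovTang

/-- **Monotonicity principle for Zagier's recurrence.** If
`(n+2)² u_{n+2} − (10(n+1)² + 10(n+1) + 3) u_{n+1} + 9(n+1)² u_n ≥ −δ` for all `n`, `0 ≤ t`,
`δ ≤ 10 t`, and `t ≤ u_k ≤ u_{k+1}`, then `t ≤ u_n ≤ u_{n+1}` for all `n ≥ k`. [folklore] -/
theorem zagierRec_mono {u : ℕ → ℝ} {δ t : ℝ} (ht : 0 ≤ t) (hδ : δ ≤ 10 * t)
    (hrec : ∀ n : ℕ, -δ ≤ ((n : ℝ) + 2) ^ 2 * u (n + 2)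
      - (10 * ((n : ℝ) + 1) ^ 2 + 10 * ((n : ℝ) + 1) + 3) * u (n + 1)
      + 9 * ((n : ℝ) + 1) ^ 2 * u n)
    {k : ℕ} (hk0 : t ≤ u k) (hk1 : u k ≤ u (k + 1)) :
    ∀ n, k ≤ n → t ≤ u n ∧ u n ≤ u (n + 1) := by
  intro n hn
  induction n with
  | zero =>
    obtain rfl : k = 0 := Nat.le_zero.mp hn
    exact ⟨hk0, hk1⟩
  | succ n ih =>
    rcases Nat.lt_or_ge n k with hlt | hge
    · obtain rfl : k = n + 1 := by omega
      exact ⟨hk0, hk1⟩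
    · obtain ⟨h0, h1⟩ := ih hge
      refine ⟨h0.trans h1, ?_⟩
      -- the step
      have hr := hrec n
      have hu1 : t ≤ u (n + 1) := h0.trans h1
      have hpos : (0 : ℝ) < ((n : ℝ) + 2) ^ 2 := by positivity
      have key : ((n : ℝ) + 2) ^ 2 * u (n + 1) ≤ ((n : ℝ) + 2) ^ 2 * u (n + 2) := by
        have hn0 : (0 : ℝ) ≤ n := Nat.cast_nonneg n
        nlinarith [mul_nonneg hn0 (sub_nonneg.mpr hu1), mul_nonneg (by norm_num : (0:ℝ) ≤ 9)
          (mul_nonneg (sq_nonneg ((n : ℝ) + 1)) (sub_nonneg.mpr h1)), sub_nonneg.mpr hu1]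
      have := le_of_mul_le_mul_left key hpos
      exact_mod_cast this

/-- The rows of Zagier's recurrence for `a_n` over `ℝ`. [cite: CalegariDimitrovTang2024, §11.1 eq. (zagr)] -/
theorem zagierC_rec_real (n : ℕ) :
    ((n : ℝ) + 2) ^ 2 * (zagierC (n + 2) : ℝ)
      - (10 * ((n : ℝ) + 1) ^ 2 + 10 * ((n : ℝ) + 1) + 3) * (zagierC (n + 1) : ℝ)
      + 9 * ((n : ℝ) + 1) ^ 2 * (zagierC n : ℝ) = 0 := by
  have h := zagierC_rec n
  exact_mod_cast h

/-- The rows of the recurrence for `b_n` over `ℝ`. [cite: CalegariDimitrovTang2024, §11.1 eq. (zagr)] -/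
theorem hB_rec_real (n : ℕ) :
    ((n : ℝ) + 2) ^ 2 * (hB (n + 2) : ℝ)
      - (10 * ((n : ℝ) + 1) ^ 2 + 10 * ((n : ℝ) + 1) + 3) * (hB (n + 1) : ℝ)
      + 9 * ((n : ℝ) + 1) ^ 2 * (hB n : ℝ) = 0 := by
  have h := hB_rec n
  exact_mod_cast h

/-- The rows of the recurrence for `c_n` over `ℝ`. [cite: CalegariDimitrovTang2024, §11.1 eq. (zagrABC)] -/
theorem hC_rec_real (n : ℕ) :
    ((n : ℝ) + 2) ^ 2 * (hC (n + 2) : ℝ)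
      - (10 * ((n : ℝ) + 1) ^ 2 + 10 * ((n : ℝ) + 1) + 3) * (hC (n + 1) : ℝ)
      + 9 * ((n : ℝ) + 1) ^ 2 * (hC n : ℝ) = 1 := by
  have h := hC_rec n
  exact_mod_cast h

/-- `0 ≤ b_n ≤ b_{n+1}`. [folklore] -/
theorem hB_nonneg_mono (n : ℕ) : 0 ≤ (hB n : ℝ) ∧ (hB n : ℝ) ≤ hB (n + 1) := by
  refine zagierRec_mono (u := fun n => (hB n : ℝ)) (δ := 0) (t := 0) le_rfl (by norm_num)
    (fun n => by rw [hB_rec_real n]; norm_num) (k := 0) ?_ ?_ n (Nat.zero_le n)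
  · simp [hB]
  · norm_num [hB]

/-- **`b_n ≤ a_n`**. [folklore] -/
theorem hB_le_zagierC (n : ℕ) : (hB n : ℝ) ≤ zagierC n := by
  have h := zagierRec_mono (u := fun n => (zagierC n : ℝ) - hB n) (δ := 0) (t := 0) le_rfl
    (by norm_num) (fun n => by
      have h1 := zagierC_rec_real n; have h2 := hB_rec_real n; linarith) (k := 0)
    (by norm_num [hB, zagierC_zero]) (by norm_num [hB, zagierC_zero, zagierC_one]) n (Nat.zero_le n)
  linarith [h.1]

/-- **`a_n ≤ 6 b_n`** for `n ≥ 1`. [folklore] -/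
theorem zagierC_le_six_mul_hB {n : ℕ} (hn : 1 ≤ n) : (zagierC n : ℝ) ≤ 6 * hB n := by
  have h := zagierRec_mono (u := fun n => (hB n : ℝ) - zagierC n / 6) (δ := 0) (t := 0) le_rfl
    (by norm_num) (fun n => by
      have h1 := zagierC_rec_real n; have h2 := hB_rec_real n; linarith) (k := 1)
    (by norm_num [hB, zagierC_one]) (by norm_num [hB, zagierC_one, zagierC_two]) n hn
  linarith [h.1]

/-- **`b_n ≤ c_n`**. [folklore] -/
theorem hB_le_hC (n : ℕ) : (hB n : ℝ) ≤ hC n := by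
  have h := zagierRec_mono (u := fun n => (hC n : ℝ) - hB n) (δ := 0) (t := 0) le_rfl
    (by norm_num) (fun n => by
      have h1 := hC_rec_real n; have h2 := hB_rec_real n; linarith) (k := 0)
    (by norm_num [hB, hC]) (by norm_num [hB, hC]) n (Nat.zero_le n)
  linarith [h.1]

/-- **`c_n ≤ a_n`** (the defect `1` of (zagrABC) is absorbed since `a_n − c_n ≥ 1`). [folklore] -/
theorem hC_le_zagierC (n : ℕ) : (hC n : ℝ) ≤ zagierC n := by
  have h := zagierRec_mono (u := fun n => (zagierC n : ℝ) - hC n) (δ := 1) (t := 1 / 10)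
    (by norm_num) (by norm_num) (fun n => by
      have h1 := zagierC_rec_real n; have h2 := hC_rec_real n; linarith) (k := 0)
    (by norm_num [hC, zagierC_zero]) (by norm_num [hC, zagierC_zero, zagierC_one]) n (Nat.zero_le n)
  linarith [h.1]

/-- Radius `1/9` from a sandwich `a_n/K ≤ u_n ≤ a_n` (`n ≥ 1`), `u_n ≥ 0`: by the bounds
`9ⁿ/((n+1)²(2n+1)) ≤ a_n ≤ 9ⁿ`. [folklore] -/
theorem radius_ofScalars_eq_of_sandwich {u : ℕ → ℝ} {K : ℝ} (hK : 0 < K)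
    (hu0 : ∀ n, 0 ≤ u n) (hup : ∀ n, u n ≤ zagierC n)
    (hlow : ∀ n, 1 ≤ n → (zagierC n : ℝ) ≤ K * u n) :
    (FormalMultilinearSeries.ofScalars ℂ (fun n => (u n : ℂ))).radius = ((1 / 9 : ℝ≥0) : ℝ≥0∞) := by
  set p := FormalMultilinearSeries.ofScalars ℂ (fun n => (u n : ℂ)) with hp
  have hnorm : ∀ n, ‖p n‖ = u n := by
    intro n
    rw [hp, FormalMultilinearSeries.ofScalars_norm, Complex.norm_real, Real.norm_of_nonneg (hu0 n)]
  apply le_antisymm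
  · by_contra hlt
    rw [not_le] at hlt
    obtain ⟨r, h19r, hrp⟩ := ENNReal.lt_iff_exists_nnreal_btwn.mp hlt
    obtain ⟨C, hC0, hC⟩ := p.norm_mul_pow_le_of_lt_radius hrp
    have hr : (1 / 9 : ℝ) < r := by
      have : ((1 / 9 : ℝ≥0) : ℝ≥0∞) < r := h19r
      exact_mod_cast this
    have h9r : 1 < 9 * (r : ℝ) := by linarith
    have hbound : ∀ n : ℕ, 1 ≤ n → (9 * (r : ℝ)) ^ n ≤ C * K * ((n + 1) ^ 2 * (2 * n + 1)) := by
      intro n hn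
      have h1 := hC n
      rw [hnorm] at h1
      have h2 : (9 : ℝ) ^ n ≤ (n + 1) ^ 2 * (2 * n + 1) * zagierC n := by
        exact_mod_cast nine_pow_le_mul_zagierC n
      have h3 := hlow n hn
      have hrn : (0 : ℝ) ≤ (r : ℝ) ^ n := by positivity
      have hP : (0 : ℝ) ≤ (n + 1) ^ 2 * (2 * n + 1) := by positivity
      calc (9 * (r : ℝ)) ^ n = 9 ^ n * (r : ℝ) ^ n := mul_pow _ _ _
        _ ≤ ((n + 1) ^ 2 * (2 * n + 1) * zagierC n) * (r : ℝ) ^ n :=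
            mul_le_mul_of_nonneg_right h2 hrn
        _ ≤ ((n + 1) ^ 2 * (2 * n + 1) * (K * u n)) * (r : ℝ) ^ n := by gcongr
        _ = ((n + 1) ^ 2 * (2 * n + 1)) * K * (u n * (r : ℝ) ^ n) := by ring
        _ ≤ ((n + 1) ^ 2 * (2 * n + 1)) * K * C := by
            exact mul_le_mul_of_nonneg_left h1 (by positivity)
        _ = C * K * ((n + 1) ^ 2 * (2 * n + 1)) := by ring
    have hlim := tendsto_pow_const_div_const_pow_of_one_lt 3 h9r
    have hCK : 0 < C * K := mul_pos hC0 hK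
    have hev : ∀ᶠ n : ℕ in atTop, (n : ℝ) ^ 3 / (9 * (r : ℝ)) ^ n < 1 / (12 * (C * K + 1)) :=
      hlim.eventually (gt_mem_nhds (by positivity))
    obtain ⟨N, hN⟩ := (hev.and (eventually_ge_atTop 1)).exists
    obtain ⟨hN1, hN2⟩ := hN
    have hpos : (0 : ℝ) < (9 * (r : ℝ)) ^ N := by positivity
    rw [div_lt_iff₀ hpos, one_div_mul_eq_div, lt_div_iff₀ (by positivity)] at hN1
    have hN2' : (1 : ℝ) ≤ N := by exact_mod_cast hN2
    have hb := hbound N hN2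
    have hpoly : ((N : ℝ) + 1) ^ 2 * (2 * N + 1) ≤ 12 * (N : ℝ) ^ 3 := by
      have e : ((N : ℝ) + 1) ^ 2 * (2 * N + 1) = 2 * (N : ℝ) ^ 3 + 5 * (N : ℝ) ^ 2 + 4 * N + 1 := by
        ring
      have hN3 : (N : ℝ) ^ 2 ≤ (N : ℝ) ^ 3 := pow_le_pow_right₀ hN2' (by norm_num)
      have hN31 : (N : ℝ) ≤ (N : ℝ) ^ 3 := le_self_pow₀ hN2' (by norm_num)
      have hN30 : (1 : ℝ) ≤ (N : ℝ) ^ 3 := one_le_pow₀ hN2'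
      rw [e]
      linarith
    have h1 : (9 * (r : ℝ)) ^ N ≤ C * K * (12 * (N : ℝ) ^ 3) :=
      hb.trans (mul_le_mul_of_nonneg_left hpoly hCK.le)
    have hY : (1 : ℝ) ≤ (N : ℝ) ^ 3 := one_le_pow₀ hN2'
    nlinarith
  · refine p.le_radius_of_bound 1 fun n => ?_
    rw [hnorm]
    have h' : u n ≤ 9 ^ n := (hup n).trans (by exact_mod_cast zagierC_le_nine_pow n)
    rw [NNReal.coe_div, NNReal.coe_one]
    push_cast
    rw [one_div, inv_pow, ← div_eq_mul_inv, div_le_one (by positivity)]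
    exact h'

/-- **The radius of convergence of `H_B(x) = Σ b_n xⁿ` is `1/9`.**
[cite: CalegariDimitrovTang2024, §11.1 Lemma 121, third bullet (p. 101)] -/
theorem radius_ofScalars_hB :
    (FormalMultilinearSeries.ofScalars ℂ (fun n => ((hB n : ℝ) : ℂ))).radius = ((1 / 9 : ℝ≥0) : ℝ≥0∞) :=
  radius_ofScalars_eq_of_sandwich (K := 6) (by norm_num) (fun n => (hB_nonneg_mono n).1)
    hB_le_zagierC (fun n hn => zagierC_le_six_mul_hB hn)

/-- **The radius of convergence of `H_C(x) = Σ c_n xⁿ` is `1/9`.**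
[cite: CalegariDimitrovTang2024, §11.1 Lemma 121, third bullet (p. 101)] -/
theorem radius_ofScalars_hC :
    (FormalMultilinearSeries.ofScalars ℂ (fun n => ((hC n : ℝ) : ℂ))).radius = ((1 / 9 : ℝ≥0) : ℝ≥0∞) :=
  radius_ofScalars_eq_of_sandwich (K := 6) (by norm_num)
    (fun n => (hB_nonneg_mono n).1.trans (hB_le_hC n)) hC_le_zagierC
    (fun n hn => (zagierC_le_six_mul_hB hn).trans (by linarith [hB_le_hC n]))

end CalegariDimitrovTang

end Literature.NumberTheory.Transcendental
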